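import Summits.BirchSwinnertonDyer.BirchSwinnertonDyer.Theorems.Rank1ResidualX9MuTransfer
import Summits.BirchSwinnertonDyer.BirchSwinnertonDyer.Theorems.Rank1ResidualX10bMuTransfer
import Summits.BirchSwinnertonDyer.BirchSwinnertonDyer.Theorems.SmallImageMuTransferAnalyticMuZeroX9RhoBarInvariance
import Summits.BirchSwinnertonDyer.Rank1Residual.GreenbergMuConjecture
import Literature.NumberTheory.EllipticCurves.Rank1Residual.MuLambdaCarriers
import HarnessLib

/-!
# Items 19629 / 19630 (+ the X10b twin, Greenberg's leaf, EPW / GV transport) BY NAME in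
# `(μ, λ)`-carrier currency (cell `bsd-f3-mu`, typer seat)

HONEST FRAMING (cell `bsd-f3-mu`, D-0131 (3) FRONTIER TIER, HOME `run/shared/lean/pub/bsd-f3-mu/`;
charter: «by what mechanism is `μ(L_p(E)) = 0 = μ(Sel)` when `ρ̄_{E,p}` is irreducible but not
surjective (X9: `5Ns`, `5S4`, `7Ns`; X10b: `3Ns`, `3Nn`), and can Greenberg–Vatsal congruence transfer be
made image-free?»; director kickoff 2026-08-27: the typer files «(μ, λ) carriers for non-surjective image
+ the GV/EPW transport statements 19629/19630 by name»).  THEOREMS ONLY; no definition, no named fact, no conjecture node, nothing asserted about any curve,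
nothing booked.  (The cell's SCOPE «good ordinary ∧ `E[p]` irreducible ∧ `ρ̄` not onto» is spelled with
the census bits `GoodOrd W p ∧ Irr W p ∧ ¬ Surj W p` of `Rank1Residual/Predicates.lean`; X9 = the
`μ`-version `Rank1ResidualX9Defs.ClassX9` = ¬cm ∧ `5 ≤ p` ∧ scope; X10b = `ClassX10 W p ∧ ¬ Surj W 3`.)
The carriers themselves (`MuAnZeroAt`, `HasMuAnAt`, `HasLambdaAnAt`, `MuAlgZeroAt`, `HasMuAlgAt`,
`HasLambdaAlgAt`: Greenberg–Vatsal 2000 (1)–(3) transcribed as per-pair predicates) are the Literature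
file `Literature/NumberTheory/EllipticCurves/Rank1Residual/MuLambdaCarriers.lean`.

What this file records, each by a few lines from tree theorems:
* §1 item 19630 `AnalyticMuZeroOnClassX9` ⟺ "every X9 pair has `MuAnZeroAt`"
  (`analyticMuZeroOnClassX9_iff`); item 19629 `KatoMuTransfer` ⟹ (`MuAnZeroAt → MuAlgZeroAt` at every
  good ordinary `p ≥ 5` with `E[p]` irreducible, ANY image) (`muAlgZeroAt_of_katoMuTransfer`); the X10b
  twin `KatoMuTransferThree` (`muAlgZeroAt_of_katoMuTransferThree`); both items ⟹ `MuAlgZeroAt` on X9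
  (`muAlgZeroAt_of_classX9` = the tree's `mu_eq_zero_of_katoMuTransfer_of_analyticMuZero`); Greenberg's
  Conj. 1.11 leaf (irreducible form) ⟹ `MuAlgZeroAt` granted cotorsion, and outright on X9 with BCS
  2025 Thm. 1.1.2 (a) supplying cotorsion.
* §2 TRANSPORT BY NAME: `muAnZeroAt_of_torsionIso` — Emerton–Pollack–Weston 2006 Thm. 1 (PUBLISHED
  fact `EmertonPollackWeston2006.thm1_muAn_transfer_of_torsionIso`; printed hypotheses: `ρ̄` irreducible,
  `p`-ordinary, `p`-distinguished — NO hypothesis on the size of the image) + period unit + Carayol +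
  modularity, through the tree's `Rank1Residual.certificate_of_torsionIso`: along a `Γ_ℚ`-equivariant
  `E[p] ≃ E'[p]` at good ordinary `p ≥ 5`, `MuAnZeroAt W p → MuAnZeroAt W' p`; composed with 19629,
  `muAlgZeroAt_of_torsionIso_of_katoMuTransfer : … → MuAnZeroAt W p → MuAlgZeroAt W' p`.  So, as printed
  and as typed, the Greenberg–Vatsal / EPW transport is ALREADY image-free (irreducibility only); what is
  NOT image-free on the small-image classes is the SOURCE of an anchor's invariants (Kato 17.4 (3) / BCS
  (b) need (im), dead on every member of `H(ρ̄)` for these `ρ̄` — `ClassX9.not_bigIm`), which is what the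
  cell's candidates must supply (HOME/CANDIDATES.md §3).

References: route `Theses/SmallImageMuTransfer.lean` (items 19629–19631); [GreenbergVatsal2000] (1)–(3),
Thm. (1.4); [EmertonPollackWeston2006] Thm. 1; [Kato2004Asterisque] Thm. 17.4, §17.13; [GreenbergLNM1716]
§1 Conj. 1.11; [BurungaleCastellaSkinner2025] Thm. 1.1.2 (a); [Carayol1986].
-/


noncomputable section

open scoped Classical MatrixGroups ModularForm

open CongruenceSubgroup WeierstrassCurve Literature.NumberTheory.EllipticCurves
  Literature.NumberTheory.EllipticCurves.ModularForms
  Literature.NumberTheory.EllipticCurves.GreenbergVatsal2000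
  Summit.BirchSwinnertonDyer.BirchSwinnertonDyer.Rank1Residual
-- only the carriers and the census bits from the Literature residual namespace: its census `ClassX9`
-- (with the rank-1 clause) must not shadow the `μ`-version `Rank1ResidualX9Defs.ClassX9` used here
open Literature.NumberTheory.EllipticCurves.Rank1Residual (MuAnZeroAt MuAlgZeroAt HasMuAnAt HasMuAlgAt
  isTorsion_of_bcs)

namespace Summit.BirchSwinnertonDyer.Rank1Residual.SmallImageMu

/-! ## §1 Items 19629 / 19630, the X10b twin and Greenberg's leaf, in carrier currency -/

section Nodes

/-- **Item 19630 per pair**: `AnalyticMuZeroOnClassX9` (= `Theses.SmallImageMuTransfer.AnalyticMuZeroX9`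
by name) is literally "every X9 pair has `μ^an = 0`". [cite: GreenbergLNM1716, §1 Conj. 1.11 (analytic side, via the main conjecture; shape only)] -/
theorem analyticMuZeroOnClassX9_iff :
    AnalyticMuZeroOnClassX9 ↔
      ∀ (W : WeierstrassCurve ℚ) [W.IsElliptic] [W.IsGloballyMinimal] (p : ℕ) [Fact p.Prime],
        ClassX9 W p → MuAnZeroAt W p := by
  constructor
  · intro h W _ _ p _ hX9 N _ f hf
    exact h W p f hX9 hf
  · intro h W _ _ p _ N _ f hX9 hf
    exact h W p hX9 f hf

variable {W : WeierstrassCurve ℚ} [W.IsElliptic] [W.IsGloballyMinimal] {p : ℕ} [Fact p.Prime]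

/-- **Item 19629 per pair**: `KatoMuTransfer` (= `Theses.SmallImageMuTransfer.MuTransfer` by name; the
`μ`-transfer at an irreducible image, `p ≥ 5`, kernel-checked modulo Kato's package F1, p482919) turns
`μ^an(E,p) = 0` into `μ^alg(E,p) = 0` at every good ordinary `p ≥ 5` with `E[p]` irreducible —
surjective OR not.  Modularity (`hmodP`, cite-only) supplies a newform at which the certificate is read.
[cite: Kato2004Asterisque, Thm. 17.4 (3) and 17.13 (p. 280)] -/
theorem muAlgZeroAt_of_katoMuTransfer (hmodP : nonempty_modularParametrizationData)
    (hT : KatoMuTransfer) (hp : 5 ≤ p) (hgood : W.HasGoodReductionAtPrime p)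
    (hord : ¬ (p : ℤ) ∣ W.frobeniusTrace p) (hirr : W.HasIrreducibleModPGaloisRep p)
    (hA : MuAnZeroAt W p) : MuAlgZeroAt W p := by
  intro κ γ hκ hγ hγ' D
  haveI : NeZero (W.conductorNorm ℤ) := ⟨(W.conductorNorm_pos_holds).ne'⟩
  obtain ⟨Dm⟩ := hmodP W
  exact hT W p Dm.f hp hgood hord hirr Dm.isNewformOf (hA Dm.f Dm.isNewformOf) κ γ hκ hγ hγ' D

/-- **The X10b twin**: `KatoMuTransferThree` turns `μ^an = 0` into `μ^alg = 0` on the scope at `p = 3`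
(kernel core `X10.coreTheoremAOddPrime_holds` unconditional; closer modulo F1).
[cite: Kato2004Asterisque, Thm. 12.6 and 17.13 (p. 280)] -/
theorem muAlgZeroAt_of_katoMuTransferThree (hmodP : nonempty_modularParametrizationData)
    (hT3 : KatoMuTransferThree) (hp3 : p = 3) (hgood : W.HasGoodReductionAtPrime p)
    (hord : ¬ (p : ℤ) ∣ W.frobeniusTrace p) (hirr : W.HasIrreducibleModPGaloisRep p)
    (hns : ¬ W.HasSurjectiveModNGaloisRep p) (hA : MuAnZeroAt W p) : MuAlgZeroAt W p := by
  intro κ γ hκ hγ hγ' D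
  haveI : NeZero (W.conductorNorm ℤ) := ⟨(W.conductorNorm_pos_holds).ne'⟩
  obtain ⟨Dm⟩ := hmodP W
  exact hT3 W p Dm.f hp3 hgood hord hirr hns Dm.isNewformOf (hA Dm.f Dm.isNewformOf) κ γ hκ hγ hγ' D

/-- **On X9 the two items give `μ^alg = 0`** (re-export of the tree's
`mu_eq_zero_of_katoMuTransfer_of_analyticMuZero` in carrier currency). [folklore] -/
theorem muAlgZeroAt_of_classX9 (hmodP : nonempty_modularParametrizationData)
    (hT : KatoMuTransfer) (hA : AnalyticMuZeroOnClassX9) (hX9 : ClassX9 W p) : MuAlgZeroAt W p :=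
  mu_eq_zero_of_katoMuTransfer_of_analyticMuZero hmodP hT hA W p hX9

omit [W.IsGloballyMinimal] in
/-- **Greenberg's Conj. 1.11 (irreducible form, the leaf `GreenbergMuConjectureIrreducible`) at the pair
⟹ `μ^alg(E,p) = 0`**, granted cotorsion of `Sel_{p^∞}(E/ℚ_∞)` for the cyclotomic data (the print's
standing assumption; a binder `htors`). [cite: GreenbergLNM1716, §1 Conj. 1.11 (p. 58)] -/
theorem muAlgZeroAt_of_greenbergMuConjectureIrreducible
    (hG : Summit.BirchSwinnertonDyer.Rank1Residual.GreenbergMuConjectureIrreducible)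
    (hirr : W.HasIrreducibleModPGaloisRep p)
    (htors : ∀ (κ : ZpExtension ℚ p) (γ : Field.absoluteGaloisGroup ℚ),
      κ.IsCyclotomic → κ.IsTopGenerator γ → IsCyclotomicVariable p γ →
      ∀ D : W.SelmerDualData κ γ, D.IsTorsion) : MuAlgZeroAt W p :=
  fun κ γ hκ hγ hγ' D => hG W p κ γ hκ hγ hirr D (htors κ γ hκ hγ hγ' D)

/-- **On X9, Greenberg's leaf gives `μ^alg = 0` outright** (cotorsion from BCS 2025 Thm. 1.1.2 (a),
`Rank1Residual.isTorsion_of_bcs`). [cite: GreenbergLNM1716, §1 Conj. 1.11 (p. 58)]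
[cite: BurungaleCastellaSkinner2025, Thm. 1.1.2 (a) (p. 2 of arXiv:2405.00270v2)] -/
theorem muAlgZeroAt_of_greenbergMuConjectureIrreducible_of_classX9
    (hG : Summit.BirchSwinnertonDyer.Rank1Residual.GreenbergMuConjectureIrreducible)
    (hBCS : burungale_castella_skinner_charIdeal_eq_padicLFunction)
    (hmodP : nonempty_modularParametrizationData) (hX9 : ClassX9 W p) : MuAlgZeroAt W p := by
  obtain ⟨-, hp, hgood, hord, hirr, -⟩ := hX9
  exact muAlgZeroAt_of_greenbergMuConjectureIrreducible hG hirr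
    (isTorsion_of_bcs hBCS hmodP hp hgood hord hirr)

end Nodes

/-! ## §2 Transport along a mod-`p` congruence (EPW Thm. 1 / GV by name) -/

section Transport

variable {W W' : WeierstrassCurve ℚ} [W.IsElliptic] [W.IsGloballyMinimal] [W'.IsElliptic]
  [W'.IsGloballyMinimal] {p : ℕ} [Fact p.Prime]

/-- **`μ^an = 0` is a `ρ̄`-invariant at good ordinary `p ≥ 5` with `E[p]` irreducible** — Emerton–
Pollack–Weston 2006 Thm. 1 (`hEPW`, PUBLISHED; printed hypotheses: `ρ̄` irreducible, `p`-ordinary,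
`p`-distinguished — NO hypothesis on the size of the image) composed with the period unit (`h5`),
Carayol (`hlev`) and modularity (`hmodP`) through the tree's `Rank1Residual.certificate_of_torsionIso`:
a `Γ_ℚ`-equivariant `E[p] ≃ E'[p]` carries `MuAnZeroAt W p` to `MuAnZeroAt W' p`.
[cite: EmertonPollackWeston2006, Thm. 1 (arXiv:math/0404484 p. 2)] [cite: GreenbergVatsal2000, §3 Remark (3.4)] -/
theorem muAnZeroAt_of_torsionIso
    (hEPW : EmertonPollackWeston2006.thm1_muAn_transfer_of_torsionIso)
    (h5 : realPeriodRat_eq_unit_mul_plusPeriod)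
    (hlev : ∀ (N : ℕ) [NeZero N], IsNewformOf.level_eq_conductorNorm (N := N))
    (hmodP : nonempty_modularParametrizationData) (hp : 5 ≤ p)
    (hgood : W.HasGoodReductionAtPrime p) (hord : ¬ (p : ℤ) ∣ W.frobeniusTrace p)
    (hirr : W.HasIrreducibleModPGaloisRep p)
    (hgood' : W'.HasGoodReductionAtPrime p) (hord' : ¬ (p : ℤ) ∣ W'.frobeniusTrace p)
    (hiso : ∃ e : geomTorsion W (p : ℤ) ≃+ geomTorsion W' (p : ℤ),
      ∀ (σ : Field.absoluteGaloisGroup ℚ) (P : geomTorsion W (p : ℤ)), e (σ • P) = σ • e P)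
    (h : MuAnZeroAt W p) : MuAnZeroAt W' p := by
  intro N' _ f' hf'
  haveI : NeZero (W.conductorNorm ℤ) := ⟨(W.conductorNorm_pos_holds).ne'⟩
  obtain ⟨Dm⟩ := hmodP W
  exact certificate_of_torsionIso hEPW h5 hlev W W' p hp hgood hord hirr hgood' hord' hiso Dm.f
    Dm.isNewformOf f' hf' (h Dm.f Dm.isNewformOf)

/-- **Transport ∘ transfer**: along a congruence `E[p] ≃ E'[p]` at good ordinary `p ≥ 5` (both
curves), `E[p]` irreducible, `μ^an(E,p) = 0` gives `μ^alg(E',p) = 0` — EPW Thm. 1, then item 19629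
(`KatoMuTransfer`) at `E'` (whose `p`-torsion is irreducible along the isomorphism,
`GreenbergVatsal2000.hasIrreducibleModPGaloisRep_of_torsionIso`).
[cite: EmertonPollackWeston2006, Thm. 1 (arXiv:math/0404484 p. 2)]
[cite: Kato2004Asterisque, Thm. 17.4 (3) and 17.13 (p. 280)] -/
theorem muAlgZeroAt_of_torsionIso_of_katoMuTransfer
    (hEPW : EmertonPollackWeston2006.thm1_muAn_transfer_of_torsionIso)
    (h5 : realPeriodRat_eq_unit_mul_plusPeriod)
    (hlev : ∀ (N : ℕ) [NeZero N], IsNewformOf.level_eq_conductorNorm (N := N))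
    (hmodP : nonempty_modularParametrizationData) (hT : KatoMuTransfer) (hp : 5 ≤ p)
    (hgood : W.HasGoodReductionAtPrime p) (hord : ¬ (p : ℤ) ∣ W.frobeniusTrace p)
    (hirr : W.HasIrreducibleModPGaloisRep p)
    (hgood' : W'.HasGoodReductionAtPrime p) (hord' : ¬ (p : ℤ) ∣ W'.frobeniusTrace p)
    (hiso : ∃ e : geomTorsion W (p : ℤ) ≃+ geomTorsion W' (p : ℤ),
      ∀ (σ : Field.absoluteGaloisGroup ℚ) (P : geomTorsion W (p : ℤ)), e (σ • P) = σ • e P)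
    (h : MuAnZeroAt W p) : MuAlgZeroAt W' p := by
  obtain ⟨e, he⟩ := hiso
  have hirr' : W'.HasIrreducibleModPGaloisRep p := hasIrreducibleModPGaloisRep_of_torsionIso e he hirr
  exact muAlgZeroAt_of_katoMuTransfer hmodP hT hp hgood' hord' hirr'
    (muAnZeroAt_of_torsionIso hEPW h5 hlev hmodP hp hgood hord hirr hgood' hord' ⟨e, he⟩ h)

/-- **The symmetric form on two X9 pairs**: for X9 pairs `(W, p)`, `(W', p)` with `E[p] ≃ E'[p]`,
`MuAnZeroAt W p ↔ MuAnZeroAt W' p` (EPW Thm. 1 both ways; irreducibility transported). One exact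
certificate per mod-`p` congruence class serves the class ∩ X9.
[cite: EmertonPollackWeston2006, Thm. 1 (arXiv:math/0404484 p. 2)] -/
theorem muAnZeroAt_iff_of_torsionIso_of_classX9
    (hEPW : EmertonPollackWeston2006.thm1_muAn_transfer_of_torsionIso)
    (h5 : realPeriodRat_eq_unit_mul_plusPeriod)
    (hlev : ∀ (N : ℕ) [NeZero N], IsNewformOf.level_eq_conductorNorm (N := N))
    (hmodP : nonempty_modularParametrizationData) (hX9 : ClassX9 W p) (hX9' : ClassX9 W' p)
    (hiso : ∃ e : geomTorsion W (p : ℤ) ≃+ geomTorsion W' (p : ℤ),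
      ∀ (σ : Field.absoluteGaloisGroup ℚ) (P : geomTorsion W (p : ℤ)), e (σ • P) = σ • e P) :
    MuAnZeroAt W p ↔ MuAnZeroAt W' p := by
  obtain ⟨-, hp, hgood, hord, hirr, -⟩ := hX9
  obtain ⟨-, -, hgood', hord', hirr', -⟩ := hX9'
  obtain ⟨e, he⟩ := hiso
  have he' : ∀ (σ : Field.absoluteGaloisGroup ℚ) (Q : geomTorsion W' (p : ℤ)),
      e.symm (σ • Q) = σ • e.symm Q := by
    intro σ Q
    apply e.injective
    rw [e.apply_symm_apply, he, e.apply_symm_apply]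
  exact ⟨muAnZeroAt_of_torsionIso hEPW h5 hlev hmodP hp hgood hord hirr hgood' hord' ⟨e, he⟩,
    muAnZeroAt_of_torsionIso hEPW h5 hlev hmodP hp hgood' hord' hirr' hgood hord ⟨e.symm, he'⟩⟩

end Transport

end Summit.BirchSwinnertonDyer.Rank1Residual.SmallImageMu

end
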